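import Summits.HodgeConjecture.HodgeConjecture.Theorems.HeckePrymWeilWeilTwelvefoldsSqrtMinus7IsotypicHeckePrymPlane
import HarnessLib

/-!
# The Hecke–Prym has dimension `12` granted Chevalley–Weil (stub `stub_heckePrymWeilPlane`, conjunct 1)

Helper file for line `isotypic-unimodular-saturation`, stub `stub_heckePrymWeilPlane`
(`--supports stmt-HodgeConjecture-1261`).  The first conjunct `dim P' = 12` of the stub is the one
place where the GEOMETRY of the étale cover enters (Chevalley–Weil: Lefschetz fixed-point formula +
`H¹(J(C)) ≅ H¹(C)`, neither in the tree).  This file reduces it, sorry-free, to ONE multiplicity: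

`heckePrym_dim_eq_twelve_of_finrank`: for the Hecke–Prym datum (`Φ₇(s_B) = 0`, `s_B t_B = t_B s_B²`,
`j ≫ t_B = j`, `t_B³ = 𝟙`, `q ≫ j = 𝟙 + t_B + t_B²`, `φ' ≫ j = j ≫ η_B`), IF the `ζ₇`-eigenspace
`W₁ = Eig(s_B^*|H¹(B(ℂ); ℂ), ζ₇)` has dimension `12` THEN `dim P = 12`.

Proof: `V := Eig(φ'^*|H¹(P), g₁)`, `g₁ = ζ+ζ²+ζ⁴-ζ³-ζ⁵-ζ⁶ = ± i√7`, equals `j^*(W₁)`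
(`⊆`: `…Coinvariants.exists_isotypic_preimage_gaussSum`; `⊇`: `φ'^* j^* = j^* η_B^*` and
`η_B^* = g₁` on `W₁`, `map_incl_eigenspace_le`), and `j^*` is injective on `W₁`
(`incl_injOn_eigenspace`: `q^* j^* w = w + t^*w + t^{*2}w` with the three summands in the
`ζ, ζ², ζ⁴`-eigenspaces of `s_B^*` — `s^* t^* = t^* s^{*2}` — and the `3 × 3` elimination has
determinant `-g₁ ≠ 0`); so `dim V = dim W₁ = 12`, and `dim P = dim V_{+i√7} = dim V_{-i√7}`
(`HodgeTheory.two_mul_finrank_eigenspace_eq`, `finrank_eigenspace_eq_finrank_eigenspace_neg`,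
`Motives.AbelianVariety.finrank_complexBetti_one`, all PROVED in the tree).  No definitions; no
named facts; the multiplicity `dim W₁ = 12` is a HYPOTHESIS (it is Chevalley–Weil for the cyclic
étale `ℤ/7`-cover `C → C/⟨σ⟩` of a genus-`7` curve: Patel–Zhang 2025 Lemma 2.9 / Lemma 5.1, Schoen
1988 Lemma 1.5 — every non-trivial character of `ℤ/7` occurs in `H¹(B)` with multiplicity
`h = 2·7 - 2 = 12`).
-/

noncomputable section

set_option linter.dupNamespace false

open CategoryTheory
open Literature.AlgebraicGeometry Literature.AlgebraicGeometry.Motives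
  Literature.AlgebraicGeometry.HodgeTheory Literature.AlgebraicTopology.SingularHomology

namespace Summit.HodgeConjecture.HodgeConjecture.Theorems.WeilTwelvefoldsSqrtMinus7.IsotypicUnimodularSaturation

section Dimension

variable {B P : AbelianVariety ℂ} {sB tB : B ⟶ B} {j : P ⟶ B} {q : B ⟶ P} {φ' : P ⟶ P}
  {S T : complexBetti B.X 1 →ₗ[ℂ] complexBetti B.X 1}
  {jH : complexBetti B.X 1 →ₗ[ℂ] complexBetti P.X 1}
  {qH : complexBetti P.X 1 →ₗ[ℂ] complexBetti B.X 1}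
  {F : complexBetti P.X 1 →ₗ[ℂ] complexBetti P.X 1}

/-- **`η_B^* = g₁` on the `ζ₇`-eigenspace of `s_B^*`**: `η_B^* w = (ζ+ζ²+ζ⁴-ζ³-ζ⁵-ζ⁶) w` for
`s_B^* w = ζ₇ w` (additivity and functoriality of pull-back on `H¹`). [folklore] -/
theorem map_heckeElement_of_mem_eigenspace (hS : S = (complexBetti.map sB.hom.hom.hom 1).hom)
    {w : complexBetti B.X 1} (hw : w ∈ Module.End.eigenspace S (Complex.exp (2 * (Real.pi : ℂ) * Complex.I / 7) ^ 1)) :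
    (complexBetti.map (sB + sB ≫ sB + sB ≫ sB ≫ sB ≫ sB - sB ≫ sB ≫ sB -
        sB ≫ sB ≫ sB ≫ sB ≫ sB - sB ≫ sB ≫ sB ≫ sB ≫ sB ≫ sB).hom.hom.hom 1).hom w =
      (Complex.exp (2 * (Real.pi : ℂ) * Complex.I / 7) + Complex.exp (2 * (Real.pi : ℂ) * Complex.I / 7) ^ 2 +
        Complex.exp (2 * (Real.pi : ℂ) * Complex.I / 7) ^ 4 - Complex.exp (2 * (Real.pi : ℂ) * Complex.I / 7) ^ 3 -
        Complex.exp (2 * (Real.pi : ℂ) * Complex.I / 7) ^ 5 - Complex.exp (2 * (Real.pi : ℂ) * Complex.I / 7) ^ 6) • w := by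
  rw [Module.End.mem_eigenspace_iff] at hw
  subst hS
  rw [complexBetti_map_sub_one, complexBetti_map_sub_one, complexBetti_map_sub_one,
    complexBetti_map_add_one, complexBetti_map_add_one]
  simp only [ModuleCat.hom_sub, ModuleCat.hom_add, LinearMap.sub_apply, LinearMap.add_apply]
  repeat rw [map_comp_one_apply]
  simp only [hw, map_smul, smul_smul]
  module

/-- **`j^*(W₁) ⊆ V_{g₁}`**: `φ'^* (j^* w) = j^* (η_B^* w) = g₁ j^* w` for `w ∈ W₁ = Eig(s_B^*, ζ₇)`.
[folklore] -/
theorem map_incl_eigenspace_le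
    (hφ' : φ' ≫ j = j ≫ (sB + sB ≫ sB + sB ≫ sB ≫ sB ≫ sB - sB ≫ sB ≫ sB -
      sB ≫ sB ≫ sB ≫ sB ≫ sB - sB ≫ sB ≫ sB ≫ sB ≫ sB ≫ sB))
    (hS : S = (complexBetti.map sB.hom.hom.hom 1).hom) (hJ : jH = (complexBetti.map j.hom.hom.hom 1).hom)
    (hF : F = (complexBetti.map φ'.hom.hom.hom 1).hom) :
    (Module.End.eigenspace S (Complex.exp (2 * (Real.pi : ℂ) * Complex.I / 7) ^ 1)).map jH ≤
      Module.End.eigenspace F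
        (Complex.exp (2 * (Real.pi : ℂ) * Complex.I / 7) + Complex.exp (2 * (Real.pi : ℂ) * Complex.I / 7) ^ 2 +
          Complex.exp (2 * (Real.pi : ℂ) * Complex.I / 7) ^ 4 - Complex.exp (2 * (Real.pi : ℂ) * Complex.I / 7) ^ 3 -
          Complex.exp (2 * (Real.pi : ℂ) * Complex.I / 7) ^ 5 - Complex.exp (2 * (Real.pi : ℂ) * Complex.I / 7) ^ 6) := by
  rintro _ ⟨w, hw, rfl⟩
  have e := map_heckeElement_of_mem_eigenspace hS hw
  subst hJ hF
  rw [Module.End.mem_eigenspace_iff]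
  have key := congrArg (fun f : P ⟶ B => (complexBetti.map f.hom.hom.hom 1).hom w) hφ'
  dsimp only at key
  rw [map_comp_one_apply, map_comp_one_apply, e, map_smul] at key
  exact key

/-- `s_B^* t_B^* = t_B^* s_B^{*2}` on `H¹(B(ℂ); ℂ)` (from `s_B t_B = t_B s_B²`). [folklore] -/
theorem map_s_map_t (hst : sB ≫ tB = tB ≫ sB ≫ sB) (hS : S = (complexBetti.map sB.hom.hom.hom 1).hom)
    (hT : T = (complexBetti.map tB.hom.hom.hom 1).hom) (x : complexBetti B.X 1) :
    S (T x) = T (S (S x)) := by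
  subst hS hT
  have key := congrArg (fun f : B ⟶ B => (complexBetti.map f.hom.hom.hom 1).hom x) hst
  dsimp only at key
  repeat rw [map_comp_one_apply] at key
  exact key

/-- `t_B^*` maps the `c`-eigenspace of `s_B^*` into the `c²`-eigenspace. [folklore] -/
theorem map_t_eigen (hst : sB ≫ tB = tB ≫ sB ≫ sB) (hS : S = (complexBetti.map sB.hom.hom.hom 1).hom)
    (hT : T = (complexBetti.map tB.hom.hom.hom 1).hom) {c : ℂ} {x : complexBetti B.X 1}
    (hx : S x = c • x) : S (T x) = (c * c) • T x := by
  rw [map_s_map_t hst hS hT, hx, map_smul, hx, map_smul, map_smul, smul_smul]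

/-- `q^* j^* = 1 + t_B^* + t_B^{*2}` on `H¹(B(ℂ); ℂ)` (`q ≫ j = 𝟙 + t_B + t_B²`). [folklore] -/
theorem map_section_map_incl (hq : q ≫ j = 𝟙 B + tB + tB ≫ tB)
    (hT : T = (complexBetti.map tB.hom.hom.hom 1).hom) (hJ : jH = (complexBetti.map j.hom.hom.hom 1).hom)
    (hQ : qH = (complexBetti.map q.hom.hom.hom 1).hom) (x : complexBetti B.X 1) :
    qH (jH x) = x + T x + T (T x) := by
  subst hT hJ hQ
  have key := congrArg (fun f : B ⟶ B => (complexBetti.map f.hom.hom.hom 1).hom x) hq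
  dsimp only at key
  rw [complexBetti_map_add_one, complexBetti_map_add_one] at key
  simp only [ModuleCat.hom_add, LinearMap.add_apply] at key
  repeat rw [map_comp_one_apply] at key
  rw [key]
  congr 2
  change (complexBetti.map (𝟙 B.X) 1).hom x = x
  rw [complexBetti.map_id]
  rfl

/-- **`j^*` is injective on `W₁ = Eig(s_B^*, ζ₇)`.**  If `j^* w = 0` then
`0 = q^* j^* w = w + t^*w + t^{*2}w` with the summands in the `ζ, ζ², ζ⁴`-eigenspaces of `s_B^*`;
applying `s_B^*` twice and eliminating (`c₁ = ζ¹⁰-ζ⁸`, `c₂ = ζ⁴-ζ⁸`, `c₃ = ζ⁴-ζ²`) leaves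
`-g₁ · w = 0`, and `g₁² = -7 ≠ 0`. [folklore] -/
theorem incl_injOn_eigenspace
    (hst : sB ≫ tB = tB ≫ sB ≫ sB) (hq : q ≫ j = 𝟙 B + tB + tB ≫ tB)
    (hS : S = (complexBetti.map sB.hom.hom.hom 1).hom) (hJ : jH = (complexBetti.map j.hom.hom.hom 1).hom)
    {w : complexBetti B.X 1} (hw : w ∈ Module.End.eigenspace S (Complex.exp (2 * (Real.pi : ℂ) * Complex.I / 7) ^ 1)) (h0 : jH w = 0) :
    w = 0 := by
  set T : complexBetti B.X 1 →ₗ[ℂ] complexBetti B.X 1 := (complexBetti.map tB.hom.hom.hom 1).hom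
    with hT
  rw [Module.End.mem_eigenspace_iff, pow_one] at hw
  -- the three equations
  have E1 : w + T w + T (T w) = 0 := by
    rw [← map_section_map_incl hq hT hJ (rfl : (complexBetti.map q.hom.hom.hom 1).hom = _) w, h0,
      map_zero]
  have hTw : S (T w) = (Complex.exp (2 * (Real.pi : ℂ) * Complex.I / 7) * Complex.exp (2 * (Real.pi : ℂ) * Complex.I / 7)) • T w :=
    map_t_eigen hst hS hT hw
  have hTTw : S (T (T w)) =
      (Complex.exp (2 * (Real.pi : ℂ) * Complex.I / 7) * Complex.exp (2 * (Real.pi : ℂ) * Complex.I / 7) *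
        (Complex.exp (2 * (Real.pi : ℂ) * Complex.I / 7) * Complex.exp (2 * (Real.pi : ℂ) * Complex.I / 7))) • T (T w) :=
    map_t_eigen hst hS hT hTw
  have E2 : Complex.exp (2 * (Real.pi : ℂ) * Complex.I / 7) • w +
      (Complex.exp (2 * (Real.pi : ℂ) * Complex.I / 7) * Complex.exp (2 * (Real.pi : ℂ) * Complex.I / 7)) • T w +
      (Complex.exp (2 * (Real.pi : ℂ) * Complex.I / 7) * Complex.exp (2 * (Real.pi : ℂ) * Complex.I / 7) *
        (Complex.exp (2 * (Real.pi : ℂ) * Complex.I / 7) * Complex.exp (2 * (Real.pi : ℂ) * Complex.I / 7))) • T (T w) = 0 := by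
    have e := congrArg S E1
    rwa [map_add, map_add, hw, hTw, hTTw, map_zero] at e
  have E3 : (Complex.exp (2 * (Real.pi : ℂ) * Complex.I / 7) * Complex.exp (2 * (Real.pi : ℂ) * Complex.I / 7)) • w +
      (Complex.exp (2 * (Real.pi : ℂ) * Complex.I / 7) * Complex.exp (2 * (Real.pi : ℂ) * Complex.I / 7) *
        (Complex.exp (2 * (Real.pi : ℂ) * Complex.I / 7) * Complex.exp (2 * (Real.pi : ℂ) * Complex.I / 7))) • T w +
      (Complex.exp (2 * (Real.pi : ℂ) * Complex.I / 7) * Complex.exp (2 * (Real.pi : ℂ) * Complex.I / 7) *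
        (Complex.exp (2 * (Real.pi : ℂ) * Complex.I / 7) * Complex.exp (2 * (Real.pi : ℂ) * Complex.I / 7)) *
        (Complex.exp (2 * (Real.pi : ℂ) * Complex.I / 7) * Complex.exp (2 * (Real.pi : ℂ) * Complex.I / 7) *
        (Complex.exp (2 * (Real.pi : ℂ) * Complex.I / 7) * Complex.exp (2 * (Real.pi : ℂ) * Complex.I / 7)))) • T (T w) = 0 := by
    have e := congrArg S E2
    rwa [map_add, map_add, map_smul, map_smul, map_smul, hw, hTw, hTTw, smul_smul, smul_smul,
      smul_smul, map_zero] at e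
  -- elimination
  have h7 := zeta7_pow_seven
  have key : ((Complex.exp (2 * (Real.pi : ℂ) * Complex.I / 7) ^ 10 - Complex.exp (2 * (Real.pi : ℂ) * Complex.I / 7) ^ 8) +
      (Complex.exp (2 * (Real.pi : ℂ) * Complex.I / 7) ^ 4 - Complex.exp (2 * (Real.pi : ℂ) * Complex.I / 7) ^ 8) * Complex.exp (2 * (Real.pi : ℂ) * Complex.I / 7) +
      (Complex.exp (2 * (Real.pi : ℂ) * Complex.I / 7) ^ 4 - Complex.exp (2 * (Real.pi : ℂ) * Complex.I / 7) ^ 2) * Complex.exp (2 * (Real.pi : ℂ) * Complex.I / 7) ^ 2) • w = 0 := by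
    have e : ((Complex.exp (2 * (Real.pi : ℂ) * Complex.I / 7) ^ 10 - Complex.exp (2 * (Real.pi : ℂ) * Complex.I / 7) ^ 8) +
        (Complex.exp (2 * (Real.pi : ℂ) * Complex.I / 7) ^ 4 - Complex.exp (2 * (Real.pi : ℂ) * Complex.I / 7) ^ 8) * Complex.exp (2 * (Real.pi : ℂ) * Complex.I / 7) +
        (Complex.exp (2 * (Real.pi : ℂ) * Complex.I / 7) ^ 4 - Complex.exp (2 * (Real.pi : ℂ) * Complex.I / 7) ^ 2) * Complex.exp (2 * (Real.pi : ℂ) * Complex.I / 7) ^ 2) • w =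
      (Complex.exp (2 * (Real.pi : ℂ) * Complex.I / 7) ^ 10 - Complex.exp (2 * (Real.pi : ℂ) * Complex.I / 7) ^ 8) • (w + T w + T (T w)) +
      (Complex.exp (2 * (Real.pi : ℂ) * Complex.I / 7) ^ 4 - Complex.exp (2 * (Real.pi : ℂ) * Complex.I / 7) ^ 8) •
        (Complex.exp (2 * (Real.pi : ℂ) * Complex.I / 7) • w +
          (Complex.exp (2 * (Real.pi : ℂ) * Complex.I / 7) * Complex.exp (2 * (Real.pi : ℂ) * Complex.I / 7)) • T w +
          (Complex.exp (2 * (Real.pi : ℂ) * Complex.I / 7) * Complex.exp (2 * (Real.pi : ℂ) * Complex.I / 7) *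
            (Complex.exp (2 * (Real.pi : ℂ) * Complex.I / 7) * Complex.exp (2 * (Real.pi : ℂ) * Complex.I / 7))) • T (T w)) +
      (Complex.exp (2 * (Real.pi : ℂ) * Complex.I / 7) ^ 4 - Complex.exp (2 * (Real.pi : ℂ) * Complex.I / 7) ^ 2) •
        ((Complex.exp (2 * (Real.pi : ℂ) * Complex.I / 7) * Complex.exp (2 * (Real.pi : ℂ) * Complex.I / 7)) • w +
          (Complex.exp (2 * (Real.pi : ℂ) * Complex.I / 7) * Complex.exp (2 * (Real.pi : ℂ) * Complex.I / 7) *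
            (Complex.exp (2 * (Real.pi : ℂ) * Complex.I / 7) * Complex.exp (2 * (Real.pi : ℂ) * Complex.I / 7))) • T w +
          (Complex.exp (2 * (Real.pi : ℂ) * Complex.I / 7) * Complex.exp (2 * (Real.pi : ℂ) * Complex.I / 7) *
            (Complex.exp (2 * (Real.pi : ℂ) * Complex.I / 7) * Complex.exp (2 * (Real.pi : ℂ) * Complex.I / 7)) *
            (Complex.exp (2 * (Real.pi : ℂ) * Complex.I / 7) * Complex.exp (2 * (Real.pi : ℂ) * Complex.I / 7) *
            (Complex.exp (2 * (Real.pi : ℂ) * Complex.I / 7) * Complex.exp (2 * (Real.pi : ℂ) * Complex.I / 7)))) • T (T w)) := by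
      module
    rw [e, E1, E2, E3, smul_zero, smul_zero, smul_zero, add_zero, add_zero]
  have hcoef : (Complex.exp (2 * (Real.pi : ℂ) * Complex.I / 7) ^ 10 - Complex.exp (2 * (Real.pi : ℂ) * Complex.I / 7) ^ 8) +
      (Complex.exp (2 * (Real.pi : ℂ) * Complex.I / 7) ^ 4 - Complex.exp (2 * (Real.pi : ℂ) * Complex.I / 7) ^ 8) * Complex.exp (2 * (Real.pi : ℂ) * Complex.I / 7) +
      (Complex.exp (2 * (Real.pi : ℂ) * Complex.I / 7) ^ 4 - Complex.exp (2 * (Real.pi : ℂ) * Complex.I / 7) ^ 2) * Complex.exp (2 * (Real.pi : ℂ) * Complex.I / 7) ^ 2 =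
      -(Complex.exp (2 * (Real.pi : ℂ) * Complex.I / 7) + Complex.exp (2 * (Real.pi : ℂ) * Complex.I / 7) ^ 2 +
        Complex.exp (2 * (Real.pi : ℂ) * Complex.I / 7) ^ 4 - Complex.exp (2 * (Real.pi : ℂ) * Complex.I / 7) ^ 3 -
        Complex.exp (2 * (Real.pi : ℂ) * Complex.I / 7) ^ 5 - Complex.exp (2 * (Real.pi : ℂ) * Complex.I / 7) ^ 6) := by
    linear_combination (Complex.exp (2 * (Real.pi : ℂ) * Complex.I / 7) ^ 3 - Complex.exp (2 * (Real.pi : ℂ) * Complex.I / 7) ^ 2 -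
      Complex.exp (2 * (Real.pi : ℂ) * Complex.I / 7)) * h7
  have hg : Complex.exp (2 * (Real.pi : ℂ) * Complex.I / 7) + Complex.exp (2 * (Real.pi : ℂ) * Complex.I / 7) ^ 2 +
      Complex.exp (2 * (Real.pi : ℂ) * Complex.I / 7) ^ 4 - Complex.exp (2 * (Real.pi : ℂ) * Complex.I / 7) ^ 3 -
      Complex.exp (2 * (Real.pi : ℂ) * Complex.I / 7) ^ 5 - Complex.exp (2 * (Real.pi : ℂ) * Complex.I / 7) ^ 6 ≠ 0 := by
    intro h0'
    have hsq := Negative.gaussSum7_sq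
    rw [h0'] at hsq
    norm_num at hsq
  rw [hcoef, neg_smul, neg_eq_zero, smul_eq_zero] at key
  exact key.resolve_left hg

/-- **`dim P = 12` from the Chevalley–Weil multiplicity `dim W₁ = 12`.** [folklore] -/
theorem heckePrym_dim_eq_twelve_of_finrank [Mono j]
    (h : 𝟙 B + sB + sB ≫ sB + sB ≫ sB ≫ sB + sB ≫ sB ≫ sB ≫ sB + sB ≫ sB ≫ sB ≫ sB ≫ sB +
      sB ≫ sB ≫ sB ≫ sB ≫ sB ≫ sB = 0)
    (hst : sB ≫ tB = tB ≫ sB ≫ sB) (hj : j ≫ tB = j) (h3 : tB ≫ tB ≫ tB = 𝟙 B)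
    (hq : q ≫ j = 𝟙 B + tB + tB ≫ tB)
    (hφ' : φ' ≫ j = j ≫ (sB + sB ≫ sB + sB ≫ sB ≫ sB ≫ sB - sB ≫ sB ≫ sB -
      sB ≫ sB ≫ sB ≫ sB ≫ sB - sB ≫ sB ≫ sB ≫ sB ≫ sB ≫ sB))
    (hW : Module.finrank ℂ (Module.End.eigenspace (complexBetti.map sB.hom.hom.hom 1).hom
      (Complex.exp (2 * (Real.pi : ℂ) * Complex.I / 7) ^ 1)) = 12) :
    P.dim = 12 := by
  haveI := finite_complexBetti_abelianVariety P 1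
  haveI := finite_complexBetti_abelianVariety B 1
  set S : complexBetti B.X 1 →ₗ[ℂ] complexBetti B.X 1 := (complexBetti.map sB.hom.hom.hom 1).hom
    with hS
  set jH : complexBetti B.X 1 →ₗ[ℂ] complexBetti P.X 1 := (complexBetti.map j.hom.hom.hom 1).hom
    with hJ
  set F : complexBetti P.X 1 →ₗ[ℂ] complexBetti P.X 1 := (complexBetti.map φ'.hom.hom.hom 1).hom
    with hF
  set g₁ : ℂ := Complex.exp (2 * (Real.pi : ℂ) * Complex.I / 7) + Complex.exp (2 * (Real.pi : ℂ) * Complex.I / 7) ^ 2 +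
      Complex.exp (2 * (Real.pi : ℂ) * Complex.I / 7) ^ 4 - Complex.exp (2 * (Real.pi : ℂ) * Complex.I / 7) ^ 3 -
      Complex.exp (2 * (Real.pi : ℂ) * Complex.I / 7) ^ 5 - Complex.exp (2 * (Real.pi : ℂ) * Complex.I / 7) ^ 6 with hg₁
  set W := Module.End.eigenspace S (Complex.exp (2 * (Real.pi : ℂ) * Complex.I / 7) ^ 1) with hWdef
  -- `V_{g₁} = j^*(W₁)` and `dim = 12`
  have hle : Module.End.eigenspace F g₁ ≤ W.map jH := by
    intro v hv
    obtain ⟨w, hw, hwv⟩ := exists_isotypic_preimage_gaussSum h hst hj h3 hq hφ' hS hJ hF v hv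
    exact ⟨w, hw, hwv⟩
  have hge : W.map jH ≤ Module.End.eigenspace F g₁ := map_incl_eigenspace_le hφ' hS hJ hF
  have hinj : Function.Injective (jH.domRestrict W) := by
    rw [injective_iff_map_eq_zero]
    intro x hx
    exact Subtype.ext (incl_injOn_eigenspace hst hq hS hJ x.2 hx)
  have hWmap : Module.finrank ℂ (W.map jH) = 12 := by
    rw [← LinearMap.range_domRestrict, LinearMap.finrank_range_of_inj hinj]
    exact hW
  have hV : Module.finrank ℂ (Module.End.eigenspace F g₁) = 12 :=
    le_antisymm (hWmap ▸ Submodule.finrank_mono hle) (hWmap ▸ Submodule.finrank_mono hge)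
  -- `dim P = dim V_{±i√7}`
  have hφ'7 : φ' ≫ φ' = -((7 : ℕ) • 𝟙 P) := by
    rw [restrict_heckeElement_comp_self h rfl hφ', ofNat_zsmul]
  have h2 := two_mul_finrank_eigenspace_eq (by norm_num : 0 < 7) hφ'7
  have hpm := finrank_eigenspace_eq_finrank_eigenspace_neg (by norm_num : 0 < 7) hφ'7
  rw [AbelianVariety.finrank_complexBetti_one] at h2
  simp only [Nat.cast_ofNat] at h2 hpm
  change 2 * Module.finrank ℂ (Module.End.eigenspace F (Complex.I * (Real.sqrt (7 : ℝ) : ℂ))) =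
    2 * P.dim at h2
  change Module.finrank ℂ (Module.End.eigenspace F (Complex.I * (Real.sqrt (7 : ℝ) : ℂ))) =
    Module.finrank ℂ (Module.End.eigenspace F (-(Complex.I * (Real.sqrt (7 : ℝ) : ℂ)))) at hpm
  rcases gaussSum_eq_or with hg | hg
  · rw [hg₁, hg] at hV
    omega
  · rw [hg₁, hg] at hV
    omega

end Dimension

/-- **`stub_heckePrymWeilPlane` GRANTED CHEVALLEY–WEIL.**  The registered stub of line
`isotypic-unimodular-saturation` (crux `HeckePrymWeil.WeilTwelvefoldsSqrtMinus7`), in its exact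
signature, follows from ONE missing fact taken here as the hypothesis `hCW` — Chevalley–Weil for the
cyclic étale `ℤ/7`-cover `C → C/⟨σ⟩` (genus `43 → 7`): the `ζ₇`-eigenspace of `s_B^*` on
`H¹(B(ℂ); ℂ)`, `B = (ker Σ_{i<7} σ_*ⁱ)⁰ = Prym(C → C/⟨σ⟩)`, has dimension `h = 2·7 - 2 = 12`
(Patel–Zhang 2025, Lemma 2.9 and Lemma 5.1; Schoen 1988, Lemma 1.5; classically: the holomorphic /
topological Lefschetz fixed-point formula for the free action and `H¹(J(C)) ≅ H¹(C)` — neither is in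
the tree, cf. `HodgeTheory.WeilClassesCyclicPrymDimension` for the `ℤ/6` analogue).  Conjunct 1 is
`heckePrym_dim_eq_twelve_of_finrank`; conjuncts 2–3 are `heckePrymWeilPlane_sq_and_algebraic`
(unconditional). CONDITIONAL on `hCW` only. [folklore] -/
theorem stub_heckePrymWeilPlane_of_chevalleyWeil
    (hCW : ∀ (C : SchemeOver ℂ) (𝒥 : Jacobian C) (σ : C ⟶ C),
      IsSmoothProjective 1 C → 𝒥.J.dim = 43 →
      σ ≫ σ ≫ σ ≫ σ ≫ σ ≫ σ ≫ σ = 𝟙 C → (∀ P : ComplexPoints C, P ≫ σ ≠ P) →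
    ∀ (s eN : 𝒥.J ⟶ 𝒥.J), s = 𝒥.pushforward 𝒥 σ →
      eN = 𝟙 𝒥.J + s + s ≫ s + s ≫ s ≫ s + s ≫ s ≫ s ≫ s + s ≫ s ≫ s ≫ s ≫ s +
        s ≫ s ≫ s ≫ s ≫ s ≫ s →
    ∀ (sB : AbelianVariety.kerComponent eN ⟶ AbelianVariety.kerComponent eN),
      sB ≫ AbelianVariety.kerComponentι eN = AbelianVariety.kerComponentι eN ≫ s →
      Module.finrank ℂ (Module.End.eigenspace (complexBetti.map sB.hom.hom.hom 1).hom
        (Complex.exp (2 * (Real.pi : ℂ) * Complex.I / 7) ^ 1)) = 12) :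
    ∀ (C : SchemeOver ℂ) (𝒥 : Jacobian C) (σ τ : C ⟶ C),
      IsSmoothProjective 1 C → 𝒥.J.dim = 43 →
      σ ≫ σ ≫ σ ≫ σ ≫ σ ≫ σ ≫ σ = 𝟙 C → τ ≫ τ ≫ τ = 𝟙 C → σ ≫ τ = τ ≫ σ ≫ σ →
      (∀ P : ComplexPoints C, P ≫ σ ≠ P ∧ P ≫ τ ≠ P) →
    ∀ (s t eN : 𝒥.J ⟶ 𝒥.J), s = 𝒥.pushforward 𝒥 σ → t = 𝒥.pushforward 𝒥 τ →
      eN = 𝟙 𝒥.J + s + s ≫ s + s ≫ s ≫ s + s ≫ s ≫ s ≫ s + s ≫ s ≫ s ≫ s ≫ s +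
        s ≫ s ≫ s ≫ s ≫ s ≫ s →
    ∀ (sB tB : AbelianVariety.kerComponent eN ⟶ AbelianVariety.kerComponent eN),
      sB ≫ AbelianVariety.kerComponentι eN = AbelianVariety.kerComponentι eN ≫ s →
      tB ≫ AbelianVariety.kerComponentι eN = AbelianVariety.kerComponentι eN ≫ t →
    ∀ (φ' : AbelianVariety.kerComponent (𝟙 (AbelianVariety.kerComponent eN) - tB) ⟶
        AbelianVariety.kerComponent (𝟙 (AbelianVariety.kerComponent eN) - tB)),
      φ' ≫ AbelianVariety.kerComponentι (𝟙 (AbelianVariety.kerComponent eN) - tB) =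
        AbelianVariety.kerComponentι (𝟙 (AbelianVariety.kerComponent eN) - tB) ≫
          (sB + sB ≫ sB + sB ≫ sB ≫ sB ≫ sB - sB ≫ sB ≫ sB - sB ≫ sB ≫ sB ≫ sB ≫ sB -
            sB ≫ sB ≫ sB ≫ sB ≫ sB ≫ sB) →
    (∀ a : ℕ, 1 ≤ a → a ≤ 6 →
      ∀ c : complexBetti (AbelianVariety.kerComponent eN).X 12,
        c ∈ Module.End.eigenspace
            (complexBetti.map ((2 : ℤ) • 𝟙 (AbelianVariety.kerComponent eN) + sB).hom.hom.hom 12).hom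
            ((2 + Complex.exp (2 * (Real.pi : ℂ) * Complex.I / 7) ^ a) ^ 12) →
        c ∈ algebraicClasses (AbelianVariety.kerComponent eN).X 6) →
    (AbelianVariety.kerComponent (𝟙 (AbelianVariety.kerComponent eN) - tB)).dim = 12 ∧
    φ' ≫ φ' = -((7 : ℤ) • 𝟙 (AbelianVariety.kerComponent (𝟙 (AbelianVariety.kerComponent eN) - tB))) ∧
    ∀ c : complexBetti (AbelianVariety.kerComponent (𝟙 (AbelianVariety.kerComponent eN) - tB)).X 12,
      c ∈ Module.End.eigenspace (complexBetti.map
              (𝟙 (AbelianVariety.kerComponent (𝟙 (AbelianVariety.kerComponent eN) - tB)) + φ').hom.hom.hom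
              12).hom ((1 + Complex.I * (Real.sqrt (7 : ℝ) : ℂ)) ^ 12) ⊔
          Module.End.eigenspace (complexBetti.map
              (𝟙 (AbelianVariety.kerComponent (𝟙 (AbelianVariety.kerComponent eN) - tB)) + φ').hom.hom.hom
              12).hom ((1 - Complex.I * (Real.sqrt (7 : ℝ) : ℂ)) ^ 12) →
      c ∈ algebraicClasses (AbelianVariety.kerComponent (𝟙 (AbelianVariety.kerComponent eN) - tB)).X 6 := by
  intro C 𝒥 σ τ hC hg hσ7 hτ3 hrel hfree s t eN hs ht heN sB tB hsB htB φ' hφ' hS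
  obtain ⟨hsq, halg⟩ := heckePrymWeilPlane_sq_and_algebraic C 𝒥 σ τ hC hg hσ7 hτ3 hrel hfree s t eN
    hs ht heN sB tB hsB htB φ' hφ' hS
  have h := kerComponent_cyclotomic₇_restrict_eq_zero heN hsB
  have hst := kerComponent_restrict_rel hsB htB (pushforward_rel 𝒥 hrel hs ht)
  have h3 := kerComponent_restrict_comp_pow_three htB (pushforward_comp_pow_three 𝒥 hτ3 ht)
  obtain ⟨q, hq⟩ := heckePrym_exists_section h3
  exact ⟨heckePrym_dim_eq_twelve_of_finrank h hst heckePrym_incl_comp h3 hq hφ'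
    (hCW C 𝒥 σ hC hg hσ7 (fun P => (hfree P).1) s eN hs heN sB hsB), hsq, halg⟩

end Summit.HodgeConjecture.HodgeConjecture.Theorems.WeilTwelvefoldsSqrtMinus7.IsotypicUnimodularSaturation

end
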